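import Mathlib

/-!
# `LieRankDesigns` (stmt-MatrixMultiplication-7614), line `Sketch`: stub C `stub_orbitSpanBound` — orbit-span dimension bound

Crux `Summit.MatrixMultiplication.MatrixMultiplication.Theses.LevelGradedCohnUmans.LieRankDesigns`; skeleton
`Cruxes/LieRankDesigns/Lines/Sketch.lean` (lead prover-line-stmt-MatrixMultiplication-7614-0, 7 registered stubs A–G);
this file proves the registered stub `stub_orbitSpanBound` verbatim (name + signature) and lands
`--supports stmt-MatrixMultiplication-7614`.

"Frobenius reciprocity without induction": for an irreducible complex representation `ρ` of a
finite group `G`, a subgroup `P ≤ G` and a non-zero subspace `W ≤ V` with `ρ(g) W ≤ W` for all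
`g ∈ P`, one has `dim V ≤ [G : P] · dim W`. Proof: `ρ(g) W = W` for `g ∈ P` (dimension count), so
`g ↦ ρ(g) W` is constant on left cosets `gP`; the span `W' = Σ_g ρ(g) W` is a non-zero `G`-stable
subspace, hence all of `V` by irreducibility, and `dim W' ≤ Σ_{c ∈ G/P} dim ρ(c) W = [G:P] dim W`.
-/

set_option linter.dupNamespace false

noncomputable section

open scoped BigOperators

namespace Summit.MatrixMultiplication.MatrixMultiplication.Theorems.LieRankDesigns

/-- Subadditivity of dimension over a finite supremum of subspaces:
`dim (⨆_{i ∈ s} P i) ≤ ∑_{i ∈ s} dim (P i)`. -/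
theorem finrank_biSup_finset_le_sum {K V : Type*} [DivisionRing K] [AddCommGroup V] [Module K V]
    [FiniteDimensional K V] {ι : Type*} (P : ι → Submodule K V) (s : Finset ι) :
    Module.finrank K (⨆ i ∈ s, P i : Submodule K V) ≤ ∑ i ∈ s, Module.finrank K (P i) := by
  classical
  induction s using Finset.induction_on with
  | empty => simp
  | insert a s ha ih =>
    rw [Finset.iSup_insert, Finset.sum_insert ha]
    exact (Submodule.finrank_add_le_finrank_add_finrank _ _).trans (Nat.add_le_add_left ih _)

/-- Subadditivity of dimension over a finite-type supremum of subspaces: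
`dim (⨆ i, P i) ≤ ∑ i, dim (P i)`. -/
theorem finrank_iSup_le_sum {K V : Type*} [DivisionRing K] [AddCommGroup V] [Module K V]
    [FiniteDimensional K V] {ι : Type*} [Fintype ι] (P : ι → Submodule K V) :
    Module.finrank K (⨆ i, P i : Submodule K V) ≤ ∑ i, Module.finrank K (P i) := by
  have h : (⨆ i, P i : Submodule K V) = ⨆ i ∈ (Finset.univ : Finset ι), P i := by simp
  rw [h]
  exact finrank_biSup_finset_le_sum P Finset.univ

/-- For a group representation, `ρ g` composed with `ρ g⁻¹` is the identity (as linear maps). -/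
theorem rep_comp_inv_eq_id {k G V : Type*} [CommSemiring k] [Group G] [AddCommMonoid V]
    [Module k V] (ρ : Representation k G V) (g : G) :
    (ρ g).comp (ρ g⁻¹) = LinearMap.id := by
  rw [← Module.End.mul_eq_comp, ← map_mul, mul_inv_cancel, map_one, Module.End.one_eq_id]

/-- Translating a subspace by `ρ g` preserves its dimension (`ρ g` is invertible). -/
theorem finrank_map_rep_eq {k G V : Type*} [Field k] [Group G] [AddCommGroup V] [Module k V]
    (ρ : Representation k G V) (g : G) (W : Submodule k V) :
    Module.finrank k (W.map (ρ g)) = Module.finrank k W := by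
  exact LinearEquiv.finrank_map_eq
    (LinearEquiv.ofLinear (ρ g) (ρ g⁻¹) (rep_comp_inv_eq_id ρ g)
      (by simpa using rep_comp_inv_eq_id ρ g⁻¹)) W

/-- Translates compose: `ρ g (ρ g' W) = ρ (g g') W`. -/
theorem map_rep_map_rep {k G V : Type*} [CommSemiring k] [Group G] [AddCommMonoid V] [Module k V]
    (ρ : Representation k G V) (g g' : G) (W : Submodule k V) :
    (W.map (ρ g')).map (ρ g) = W.map (ρ (g * g')) := by
  rw [map_mul, Module.End.mul_eq_comp, Submodule.map_comp]

/-- **Orbit-span bound** ("Frobenius reciprocity without induction"): for an irreducible complex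
representation `ρ` of a finite group `G`, a subgroup `P` and a non-zero subspace `W` stable under
`ρ(P)`, `dim V ≤ [G : P] · dim W`. Indeed `V = Σ_{gP ∈ G/P} ρ(g) W` by irreducibility. -/
theorem stub_orbitSpanBound :
    ∀ (G : Type) [Group G] [Fintype G] (V : Type) [AddCommGroup V] [Module ℂ V] [FiniteDimensional ℂ V]
      (ρ : Representation ℂ G V), ρ.IsIrreducible →
      ∀ (P : Subgroup G) (W : Submodule ℂ V), W ≠ ⊥ → (∀ g ∈ P, W.map (ρ g) ≤ W) →
        Module.finrank ℂ V ≤ P.index * Module.finrank ℂ W := by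
  intro G _ _ V _ _ _ ρ hρ P W hW hPW
  classical
  -- Step 1: `ρ g W = W` for `g ∈ P`.
  have hstab : ∀ g ∈ P, W.map (ρ g) = W := fun g hg =>
    Submodule.eq_of_le_of_finrank_eq (hPW g hg) (finrank_map_rep_eq ρ g W)
  -- Step 2: `g ↦ ρ g W` is constant on left cosets of `P`.
  set F : G ⧸ P → Submodule ℂ V := fun c => W.map (ρ c.out) with hF
  have hcoset : ∀ g : G, W.map (ρ g) = F (QuotientGroup.mk g) := by
    intro g
    obtain ⟨p, hp⟩ := QuotientGroup.mk_out_eq_mul P g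
    simp only [hF]
    rw [hp, ← map_rep_map_rep, hstab _ p.2]
  -- Step 3: the orbit span `W' = ⨆ g, ρ g W` is a non-zero subrepresentation.
  set W' : Submodule ℂ V := ⨆ g : G, W.map (ρ g) with hW'
  have hW'stab : ∀ g : G, W'.map (ρ g) ≤ W' := by
    intro g
    rw [hW', Submodule.map_iSup]
    refine iSup_le fun g' => ?_
    rw [map_rep_map_rep]
    exact le_iSup (fun x : G => W.map (ρ x)) (g * g')
  let S : Subrepresentation ρ := ⟨W', fun g v hv => hW'stab g (Submodule.mem_map_of_mem hv)⟩
  have hWle : W ≤ W' := by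
    have h1 : W.map (ρ 1) = W := by rw [map_one, Module.End.one_eq_id, Submodule.map_id]
    calc W = W.map (ρ 1) := h1.symm
      _ ≤ W' := le_iSup (fun x : G => W.map (ρ x)) 1
  have hSne : S ≠ ⊥ := by
    intro h
    have h' : W' = ⊥ := congrArg Subrepresentation.toSubmodule h
    exact hW (eq_bot_iff.mpr (h' ▸ hWle))
  -- Step 4: irreducibility forces `W' = V`.
  haveI := hρ
  have hStop : S = ⊤ := (IsSimpleOrder.eq_bot_or_eq_top S).resolve_left hSne
  have hW'top : W' = ⊤ := congrArg Subrepresentation.toSubmodule hStop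
  -- Step 5: count dimensions over `G ⧸ P`.
  have hW'le : W' ≤ ⨆ c : G ⧸ P, F c :=
    iSup_le fun g => (hcoset g).le.trans (le_iSup F (QuotientGroup.mk g))
  have hFdim : ∀ c : G ⧸ P, Module.finrank ℂ (F c) = Module.finrank ℂ W := fun c =>
    finrank_map_rep_eq ρ c.out W
  calc Module.finrank ℂ V = Module.finrank ℂ (⊤ : Submodule ℂ V) := (finrank_top ℂ V).symm
    _ = Module.finrank ℂ W' := by rw [hW'top]
    _ ≤ Module.finrank ℂ (⨆ c : G ⧸ P, F c : Submodule ℂ V) := Submodule.finrank_mono hW'le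
    _ ≤ ∑ c : G ⧸ P, Module.finrank ℂ (F c) := finrank_iSup_le_sum F
    _ = ∑ _c : G ⧸ P, Module.finrank ℂ W := Finset.sum_congr rfl fun c _ => hFdim c
    _ = P.index * Module.finrank ℂ W := by
      rw [Finset.sum_const, Finset.card_univ, smul_eq_mul, Subgroup.index_eq_card,
        Nat.card_eq_fintype_card]

end Summit.MatrixMultiplication.MatrixMultiplication.Theorems.LieRankDesigns

end
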